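import Literature.AlgebraicGeometry.Motives.HodgeLieUnitaryTimesCMCurveSU
import Literature.AlgebraicGeometry.Motives.HodgeThetaSubalgebraUnitaryTransfer
import HarnessLib

/-!
# `𝔰𝔲_K(V, ψ)_ℂ = [𝔲_K(V, ψ)_ℂ, 𝔲_K(V, ψ)_ℂ]`: a `φ_ℂ`-commuting `ψ_ℂ`-skew operator with `tr(φ_ℂ T) = 0` is a combination of commutators of such operators (weight one, `End_Hdg = ℚ + ℚφ`, `φ² = −d`) — the input `hSL₁` of the Weil PRODUCT brick

Family `hodge`, layer `Literature/AlgebraicGeometry/Motives`, namespace `Literature.AlgebraicGeometry.Motives.HodgeStructure`,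
sub-namespace `UnitarySU`. THEOREMS ONLY (no definition, no named fact, no instance, no `sorry`). Written for the cell `pub-hodgeav-hg6`
(req-37 (A) Q2b, TABLE X Weil PRODUCT rows 17 / 19 / 20 / 22; brick K1b of the lead's T-line 2026-08-29: it discharges, for every
`(H, φ, ψ)` with `End_Hdg(H) = ℚ + ℚφ`, the displayed hypothesis `hSL₁` of `WeilProductCM.mem_hodgeLieC_of_commute_of_skew_of_trace`
(`Motives/HodgeLieUnitaryTimesCMCurveSU`)). HONEST FRAMING of that cell: HC / HC_AV (stmt-1333) / HC_CM (stmt-3052) / H2 are NOT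
proved anywhere in this file; unconditional linear algebra.

SETTING (`Motives/HodgeThetaSubalgebraUnitary`): `H` an effective polarized `ℚ`-Hodge structure of weight `1`, `φ ∈ End_Hdg(V)`,
`φ² = −d` (`d > 0`), `End_Hdg(V) = ℚ + ℚφ` (so `φ` is `ψ`-skew: the Rosati involution is complex conjugation), `μ² = −d`,
`W = ker(φ_ℂ − μ)`, `W′ = ker(φ_ℂ + μ)`, `V_ℂ = W ⊕ W′`, `ψ_ℂ : W′ ⥲ W^∨` (`UnitaryTheta.flip_pairing_bijective`). The Lie algebra
`𝔲 = {T : T φ_ℂ = φ_ℂ T, T ψ_ℂ-skew}` restricts isomorphically onto `𝔤𝔩(W)` (Gordon: «`Y|_{W′} = −(Y|_W)ᵗ`»).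

* §1 `UnitarySU.matrix_mem_span_commutator_of_trace_eq_zero` — a traceless square matrix is a combination of commutators
  (`E_{ij} = [E_{ii}, E_{ij}]`, `E_{ii} − E_{i₀i₀} = [E_{ii₀}, E_{i₀i}]`; `𝔰𝔩_n = [𝔤𝔩_n, 𝔤𝔩_n]`).
* §2 `UnitarySU.exists_extension` — every `T₀ ∈ End(W)` is the restriction of an element of `𝔲` (`T₀ ⊕ (−T₀ᵗ)` through the pairing).
* §3 **`UnitarySU.mem_span_commutator_of_trace`** — `T ∈ 𝔲` with `tr(φ_ℂ T) = 0` lies in `span_ℂ {[A, B] : A, B ∈ 𝔲}`: `tr T = 0`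
  (skew), so `2μ tr(T|_W) = μ tr T + tr(φ_ℂ T) = 0` (`WeilProductCM.two_mul_mul_trace_restrict_eq`); `T|_W` is a combination of commutators
  in `End(W)` (§1), each the restriction of a commutator in `𝔲` (§2); the combination agrees with `T` on `W`, hence equals `T`
  (`UnitaryTheta.eq_zero_of_forall_mem_eigenspace`). The statement is exactly the `∀ ψ₁`-instance of the hypothesis `hSL₁` of the
  product brick.

## References
* [Humphreys1972] J. E. Humphreys, Introduction to Lie Algebras and Representation Theory, GTM 9, §1.2 (`𝔰𝔩`), §19.1 (`𝔤𝔩 = 𝔷 ⊕ 𝔰𝔩`).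
* [Gordon1997] B. B. Gordon, A survey of the Hodge conjecture for abelian varieties, §6 (proof of Thm. 6.3.3, p. 19).
* [MoonenZarhin1999LowDim] B. Moonen, Yu. Zarhin, Math. Ann. 315 (1999), §2 (2.3).
* [Ribet1983] K. A. Ribet, Amer. J. Math. 105 (1983), Thm. 3.
-/

noncomputable section

open scoped TensorProduct

namespace Literature.AlgebraicGeometry.Motives

namespace HodgeStructure

universe u

/-! ## §1 Traceless matrices are combinations of commutators -/

/-- **`𝔰𝔩_n(R) ⊆ [𝔤𝔩_n(R), 𝔤𝔩_n(R)]`**: a square matrix with trace `0` is an `R`-combination of commutators `AB − BA`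
(`E_{ij} = E_{ii}E_{ij} − E_{ij}E_{ii}` for `i ≠ j`, `E_{ii} − E_{i₀i₀} = E_{ii₀}E_{i₀i} − E_{i₀i}E_{ii₀}`, and
`Σ_i M_{ii} E_{i₀i₀} = (tr M) E_{i₀i₀} = 0`). [cite: Humphreys1972, §1.2] -/
theorem UnitarySU.matrix_mem_span_commutator_of_trace_eq_zero {ι : Type*} [Fintype ι] [DecidableEq ι]
    {R : Type*} [CommRing R] (M : Matrix ι ι R) (hM : M.trace = 0) :
    M ∈ Submodule.span R {C : Matrix ι ι R | ∃ A B : Matrix ι ι R, C = A * B - B * A} := by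
  classical
  set S := Submodule.span R {C : Matrix ι ι R | ∃ A B : Matrix ι ι R, C = A * B - B * A} with hS
  rcases isEmpty_or_nonempty ι with hι | ⟨⟨i₀⟩⟩
  · have h0 : M = 0 := Matrix.ext fun i _ => (IsEmpty.false i).elim
    rw [h0]
    exact Submodule.zero_mem _
  have hoff : ∀ i j, i ≠ j → Matrix.single i j (1 : R) ∈ S := fun i j hij =>
    Submodule.subset_span ⟨Matrix.single i i 1, Matrix.single i j 1, by
      rw [Matrix.single_mul_single_same, Matrix.single_mul_single_of_ne (1 : R) i j i hij.symm (1 : R), mul_one, sub_zero]⟩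
  have hdiag : ∀ i, Matrix.single i i (1 : R) - Matrix.single i₀ i₀ 1 ∈ S := fun i =>
    Submodule.subset_span ⟨Matrix.single i i₀ 1, Matrix.single i₀ i 1, by
      rw [Matrix.single_mul_single_same, Matrix.single_mul_single_same, mul_one]⟩
  have htr : ∑ i, M i i = 0 := by simpa [Matrix.trace] using hM
  have key : ∀ i j, Matrix.single i j (M i j) =
      (if i = j then M i j • (Matrix.single i i (1 : R) - Matrix.single i₀ i₀ 1) else M i j • Matrix.single i j 1) +
        (if i = j then M i j • Matrix.single i₀ i₀ (1 : R) else 0) := by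
    intro i j
    split_ifs with h
    · subst h
      rw [smul_sub, sub_add_cancel, Matrix.smul_single, smul_eq_mul, mul_one]
    · rw [add_zero, Matrix.smul_single, smul_eq_mul, mul_one]
  have hsum2 : ∑ i, ∑ j, (if i = j then M i j • Matrix.single i₀ i₀ (1 : R) else 0) = 0 := by
    simp_rw [Finset.sum_ite_eq, Finset.mem_univ, if_true]
    rw [← Finset.sum_smul, htr, zero_smul]
  rw [Matrix.matrix_eq_sum_single M]
  simp_rw [key, Finset.sum_add_distrib]
  rw [hsum2, add_zero]
  refine Submodule.sum_mem _ fun i _ => Submodule.sum_mem _ fun j _ => ?_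
  split_ifs with h
  · exact S.smul_mem _ (hdiag i)
  · exact S.smul_mem _ (hoff i j h)

/-! ## §2 The setting; extension from `W` -/

variable {V : Type u} [AddCommGroup V] [Module ℚ V] [Module.Finite ℚ V] {n : ℤ}

/-- **Every endomorphism of `W` is the restriction of a `φ_ℂ`-commuting `ψ_ℂ`-skew operator** (`𝔲_K(V,ψ)_ℂ ↠ 𝔤𝔩(W)`): with the
perfect pairing `ψ_ℂ : W′ ⥲ W^∨` put `T₀′ = −(ψ_ℂ♭)⁻¹ ∘ T₀ᵗ ∘ ψ_ℂ♭` on `W′` and `Z = T₀ ⊕ T₀′` on `V_ℂ = W ⊕ W′`; `Z` preserves the two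
eigenspaces (so commutes with `φ_ℂ`) and is skew since `W`, `W′` are isotropic and `ψ_ℂ(T₀ w, w′) + ψ_ℂ(w, T₀′ w′) = 0`. (Gordon: in adapted
letters every element of `𝔲_ℂ` is `X ⊕ (−Xᵀ)`, and conversely.) [cite: Gordon1997, §6 (proof of Thm. 6.3.3, p. 19)]
[cite: MoonenZarhin1999LowDim, §2 (2.3)] -/
theorem UnitarySU.exists_extension [Nontrivial V] (H : HodgeStructure V n) (hn : n = 1) (ψ : H.Polarization)
    {φ : Module.End ℚ V} (hφE : φ ∈ H.endAlg) {d : ℚ} (hd : 0 < d) (hφ2 : φ * φ = -(d • 1))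
    (hE : ∀ a ∈ H.endAlg, ∃ x y : ℚ, a = x • 1 + y • φ) {μ : ℂ} (hμ : μ ^ 2 = -(d : ℂ))
    (T₀ : Module.End ℂ ↥(Module.End.eigenspace (φ.baseChange ℂ) μ)) :
    ∃ Z : Module.End ℂ (ℂ ⊗[ℚ] V), Z * φ.baseChange ℂ = φ.baseChange ℂ * Z ∧
      (∀ x y, ψ.form.baseChange ℂ (Z x) y + ψ.form.baseChange ℂ x (Z y) = 0) ∧
      ∀ w : ↥(Module.End.eigenspace (φ.baseChange ℂ) μ), Z (w : ℂ ⊗[ℚ] V) = (T₀ w : ℂ ⊗[ℚ] V) := by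
  classical
  obtain ⟨hμ0, -⟩ := UnitaryTheta.conj_eq_neg_of_sq hd hμ
  set W' := Module.End.eigenspace (φ.baseChange ℂ) (-μ) with hW'def
  set ψC := ψ.form.baseChange ℂ with hψC
  have hφskew : ∀ x y, ψC (φ.baseChange ℂ x) y + ψC x (φ.baseChange ℂ y) = 0 :=
    ThetaSubalgebra.formBaseChange_add_eq_zero_of_skew ψ (UnitaryTheta.form_apply_add_form_apply_eq_zero H ψ hφE hd hφ2 hE)
  have hWW : ∀ x ∈ (Module.End.eigenspace (φ.baseChange ℂ) μ), ∀ y ∈ (Module.End.eigenspace (φ.baseChange ℂ) μ),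
      ψC x y = 0 := fun x hx y hy => UnitaryTheta.form_eq_zero_of_mem_eigenspace hφskew hμ0 hx hy
  have hW'W' : ∀ x ∈ W', ∀ y ∈ W', ψC x y = 0 := fun x hx y hy =>
    UnitaryTheta.form_eq_zero_of_mem_eigenspace hφskew (neg_ne_zero.2 hμ0) hx hy
  have hswap : ∀ x y, ψC y x = -ψC x y := form_baseChange_swap_of_odd H (hn ▸ odd_one) ψ
  have hc : IsCompl (Module.End.eigenspace (φ.baseChange ℂ) μ) W' := UnitaryTheta.isCompl_eigenspace hd hφ2 hμ
  -- the pairing `β : W′ ⥲ W^∨`, `β w′ w = ψ_ℂ(w, w′)` (`W = ker(φ_ℂ − μ)`)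
  have hbij := UnitaryTheta.flip_pairing_bijective H hn ψ hφE hd hφ2 hE hμ
  let β : ↥W' ≃ₗ[ℂ] Module.Dual ℂ ↥(Module.End.eigenspace (φ.baseChange ℂ) μ) := LinearEquiv.ofBijective _ hbij
  have hβ : ∀ (w' : ↥W') (w : ↥(Module.End.eigenspace (φ.baseChange ℂ) μ)), β w' w = ψC w w' := fun _ _ => rfl
  -- the partner on `(Module.End.eigenspace (φ.baseChange ℂ) μ)′`
  let T₀' : Module.End ℂ ↥W' := β.symm.toLinearMap ∘ₗ (-T₀.dualMap) ∘ₗ β.toLinearMap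
  have hT₀' : ∀ (w : ↥(Module.End.eigenspace (φ.baseChange ℂ) μ)) (w' : ↥W'), ψC (T₀ w) w' + ψC w (T₀' w') = 0 := by
    intro w w'
    have h : β (T₀' w') = -(T₀.dualMap (β w')) := by
      change β (β.symm ((-T₀.dualMap) (β w'))) = _
      rw [LinearEquiv.apply_symm_apply, LinearMap.neg_apply]
    have h' := congrArg (fun f : Module.Dual ℂ ↥(Module.End.eigenspace (φ.baseChange ℂ) μ) => f w) h
    simp only [LinearMap.neg_apply, LinearMap.dualMap_apply] at h'
    rw [hβ, hβ] at h'
    rw [h', add_neg_cancel]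
  let Z : Module.End ℂ (ℂ ⊗[ℚ] V) := LinearMap.ofIsCompl hc ((Module.End.eigenspace (φ.baseChange ℂ) μ).subtype ∘ₗ T₀) (W'.subtype ∘ₗ T₀')
  have hZw : ∀ w : ↥(Module.End.eigenspace (φ.baseChange ℂ) μ), Z w = T₀ w := fun w => by
    change LinearMap.ofIsCompl hc _ _ (w : ℂ ⊗[ℚ] V) = _
    rw [LinearMap.ofIsCompl_apply_left]; rfl
  have hZw' : ∀ w' : ↥W', Z w' = T₀' w' := fun w' => by
    change LinearMap.ofIsCompl hc _ _ (w' : ℂ ⊗[ℚ] V) = _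
    rw [LinearMap.ofIsCompl_apply_right]; rfl
  refine ⟨Z, ?_, ?_, hZw⟩
  · refine LinearMap.ext fun v => ?_
    obtain ⟨w, hw, w', hw', rfl⟩ := UnitaryTheta.exists_eigen_add_eigen hφ2 hμ hμ0 v
    have h1 : Z w = (T₀ ⟨w, hw⟩ : ℂ ⊗[ℚ] V) := hZw ⟨w, hw⟩
    have h2 : Z w' = (T₀' ⟨w', hw'⟩ : ℂ ⊗[ℚ] V) := hZw' ⟨w', hw'⟩
    rw [Module.End.mul_apply, Module.End.mul_apply, map_add, Module.End.mem_eigenspace_iff.1 hw,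
      Module.End.mem_eigenspace_iff.1 hw', map_add, map_smul, map_smul, map_add, h1, h2, map_add,
      Module.End.mem_eigenspace_iff.1 (T₀ ⟨w, hw⟩).2, Module.End.mem_eigenspace_iff.1 (T₀' ⟨w', hw'⟩).2]
  · intro x y
    obtain ⟨w₁, hw₁, w₁', hw₁', rfl⟩ := UnitaryTheta.exists_eigen_add_eigen hφ2 hμ hμ0 x
    obtain ⟨w₂, hw₂, w₂', hw₂', rfl⟩ := UnitaryTheta.exists_eigen_add_eigen hφ2 hμ hμ0 y
    have h1 : Z w₁ = (T₀ ⟨w₁, hw₁⟩ : ℂ ⊗[ℚ] V) := hZw ⟨w₁, hw₁⟩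
    have h1' : Z w₁' = (T₀' ⟨w₁', hw₁'⟩ : ℂ ⊗[ℚ] V) := hZw' ⟨w₁', hw₁'⟩
    have h2 : Z w₂ = (T₀ ⟨w₂, hw₂⟩ : ℂ ⊗[ℚ] V) := hZw ⟨w₂, hw₂⟩
    have h2' : Z w₂' = (T₀' ⟨w₂', hw₂'⟩ : ℂ ⊗[ℚ] V) := hZw' ⟨w₂', hw₂'⟩
    have hA := hT₀' ⟨w₁, hw₁⟩ ⟨w₂', hw₂'⟩
    have hB := hT₀' ⟨w₂, hw₂⟩ ⟨w₁', hw₁'⟩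
    simp only at hA hB
    have hZ1 : Z (w₁ + w₁') = (T₀ ⟨w₁, hw₁⟩ : ℂ ⊗[ℚ] V) + (T₀' ⟨w₁', hw₁'⟩ : ℂ ⊗[ℚ] V) := by rw [map_add, h1, h1']
    have hZ2 : Z (w₂ + w₂') = (T₀ ⟨w₂, hw₂⟩ : ℂ ⊗[ℚ] V) + (T₀' ⟨w₂', hw₂'⟩ : ℂ ⊗[ℚ] V) := by rw [map_add, h2, h2']
    have z1 : ψC (T₀ ⟨w₁, hw₁⟩ : ℂ ⊗[ℚ] V) w₂ = 0 := hWW _ (T₀ ⟨w₁, hw₁⟩).2 _ hw₂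
    have z2 : ψC (T₀' ⟨w₁', hw₁'⟩ : ℂ ⊗[ℚ] V) w₂' = 0 := hW'W' _ (T₀' ⟨w₁', hw₁'⟩).2 _ hw₂'
    have z3 : ψC w₁ (T₀ ⟨w₂, hw₂⟩ : ℂ ⊗[ℚ] V) = 0 := hWW _ hw₁ _ (T₀ ⟨w₂, hw₂⟩).2
    have z4 : ψC w₁' (T₀' ⟨w₂', hw₂'⟩ : ℂ ⊗[ℚ] V) = 0 := hW'W' _ hw₁' _ (T₀' ⟨w₂', hw₂'⟩).2
    have s1 : ψC (T₀' ⟨w₁', hw₁'⟩ : ℂ ⊗[ℚ] V) w₂ = -ψC w₂ (T₀' ⟨w₁', hw₁'⟩ : ℂ ⊗[ℚ] V) := hswap _ _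
    have s2 : ψC w₁' (T₀ ⟨w₂, hw₂⟩ : ℂ ⊗[ℚ] V) = -ψC (T₀ ⟨w₂, hw₂⟩ : ℂ ⊗[ℚ] V) w₁' := hswap _ _
    rw [hZ1, hZ2]
    simp only [map_add, LinearMap.add_apply]
    linear_combination z1 + z2 + z3 + z4 + hA + s1 + s2 - hB

/-! ## §3 `𝔰𝔲_ℂ = [𝔲_ℂ, 𝔲_ℂ]` -/

/-- **`𝔰𝔲_K(V,ψ)_ℂ = [𝔲_K(V,ψ)_ℂ, 𝔲_K(V,ψ)_ℂ]` (the hypothesis `hSL₁` of `WeilProductCM.mem_hodgeLieC_of_commute_of_skew_of_trace`).**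
For `H` effective of weight `1` with polarization `ψ`, `φ ∈ End_Hdg(V)`, `φ² = −d < 0`, `End_Hdg(V) = ℚ + ℚφ`: every operator `T` of
`V_ℂ` commuting with `φ_ℂ`, `ψ_ℂ`-skew and with `tr(φ_ℂ T) = 0` is a complex combination of commutators `AB − BA` of `φ_ℂ`-commuting
`ψ_ℂ`-skew operators. Proof: module docstring §3 (`tr(T|_W) = 0`; `𝔰𝔩(W) = [𝔤𝔩(W), 𝔤𝔩(W)]`; extension `𝔤𝔩(W) → 𝔲_ℂ`; determination on
`W`). [cite: Humphreys1972, §19.1] [cite: Gordon1997, §6 (proof of Thm. 6.3.3, p. 19)] [cite: MoonenZarhin1999LowDim, §2 (2.3)]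
[cite: Ribet1983, Thm. 3] -/
theorem UnitarySU.mem_span_commutator_of_trace (H : HodgeStructure V n) (hn : n = 1) (ψ : H.Polarization)
    {φ : Module.End ℚ V} (hφE : φ ∈ H.endAlg) {d : ℚ} (hd : 0 < d) (hφ2 : φ * φ = -(d • 1))
    (hE : ∀ a ∈ H.endAlg, ∃ x y : ℚ, a = x • 1 + y • φ) {T : Module.End ℂ (ℂ ⊗[ℚ] V)}
    (hTφ : T * φ.baseChange ℂ = φ.baseChange ℂ * T)
    (hTskew : ∀ x y, ψ.form.baseChange ℂ (T x) y + ψ.form.baseChange ℂ x (T y) = 0)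
    (htr : LinearMap.trace ℂ _ (φ.baseChange ℂ * T) = 0) :
    T ∈ Submodule.span ℂ {D : Module.End ℂ (ℂ ⊗[ℚ] V) | ∃ A B : Module.End ℂ (ℂ ⊗[ℚ] V),
      A * φ.baseChange ℂ = φ.baseChange ℂ * A ∧ B * φ.baseChange ℂ = φ.baseChange ℂ * B ∧
      (∀ x y, ψ.form.baseChange ℂ (A x) y + ψ.form.baseChange ℂ x (A y) = 0) ∧
      (∀ x y, ψ.form.baseChange ℂ (B x) y + ψ.form.baseChange ℂ x (B y) = 0) ∧ D = A * B - B * A} := by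
  classical
  -- the degenerate case `V = 0`
  rcases subsingleton_or_nontrivial V with hV | hV
  · have h0 : ∀ z : ℂ ⊗[ℚ] V, z = 0 := fun z => by
      induction z using TensorProduct.induction_on with
      | zero => rfl
      | tmul c v => rw [Subsingleton.elim v 0, TensorProduct.tmul_zero]
      | add a b ha hb => rw [ha, hb, add_zero]
    have hT0 : T = 0 := LinearMap.ext fun z => by rw [h0 z, map_zero, map_zero]
    rw [hT0]
    exact Submodule.zero_mem _
  obtain ⟨μ, hμ⟩ := IsAlgClosed.exists_pow_nat_eq (-(d : ℂ)) two_pos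
  obtain ⟨hμ0, -⟩ := UnitaryTheta.conj_eq_neg_of_sq hd hμ
  set φC := φ.baseChange ℂ with hφC
  set ψC := ψ.form.baseChange ℂ with hψC
  set W := Module.End.eigenspace (φ.baseChange ℂ) μ with hWdef
  set S := Submodule.span ℂ {D : Module.End ℂ (ℂ ⊗[ℚ] V) | ∃ A B : Module.End ℂ (ℂ ⊗[ℚ] V),
      A * φC = φC * A ∧ B * φC = φC * B ∧ (∀ x y, ψC (A x) y + ψC x (A y) = 0) ∧
      (∀ x y, ψC (B x) y + ψC x (B y) = 0) ∧ D = A * B - B * A} with hSdef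
  -- elements of `S` commute with `φ_ℂ` and are skew
  have hgenφ : ∀ A B : Module.End ℂ (ℂ ⊗[ℚ] V), A * φC = φC * A → B * φC = φC * B →
      (A * B - B * A) * φC = φC * (A * B - B * A) := fun A B hA hB => by
    rw [sub_mul, mul_sub, mul_assoc, mul_assoc, hB, hA, ← mul_assoc, ← mul_assoc, hA, hB, mul_assoc, mul_assoc]
  have hgenskew : ∀ A B : Module.End ℂ (ℂ ⊗[ℚ] V), (∀ x y, ψC (A x) y + ψC x (A y) = 0) →
      (∀ x y, ψC (B x) y + ψC x (B y) = 0) → ∀ x y, ψC ((A * B - B * A) x) y + ψC x ((A * B - B * A) y) = 0 := by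
    intro A B hA hB x y
    have h1 := hA (B x) y
    have h2 := hB x (A y)
    have h3 := hB (A x) y
    have h4 := hA x (B y)
    rw [LinearMap.sub_apply, LinearMap.sub_apply, Module.End.mul_apply, Module.End.mul_apply, Module.End.mul_apply,
      Module.End.mul_apply, map_sub, LinearMap.sub_apply, map_sub]
    linear_combination h1 - h2 - h3 + h4
  have hSφ : ∀ D ∈ S, D * φC = φC * D := by
    intro D hD
    induction hD using Submodule.span_induction with
    | mem D h =>
      obtain ⟨A, B, hA, hB, -, -, rfl⟩ := h
      exact hgenφ A B hA hB
    | zero => rw [zero_mul, mul_zero]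
    | add D D' _ _ h h' => rw [add_mul, mul_add, h, h']
    | smul a D _ h => rw [smul_mul_assoc, mul_smul_comm, h]
  have hSskew : ∀ D ∈ S, ∀ x y, ψC (D x) y + ψC x (D y) = 0 := by
    intro D hD
    induction hD using Submodule.span_induction with
    | mem D h =>
      obtain ⟨A, B, -, -, hA, hB, rfl⟩ := h
      exact hgenskew A B hA hB
    | zero => intro x y; rw [LinearMap.zero_apply, LinearMap.zero_apply, map_zero, LinearMap.zero_apply, map_zero, add_zero]
    | add D D' _ _ h h' =>
      intro x y
      rw [LinearMap.add_apply, LinearMap.add_apply, map_add, LinearMap.add_apply, map_add]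
      linear_combination h x y + h' x y
    | smul a D _ h =>
      intro x y
      rw [LinearMap.smul_apply, LinearMap.smul_apply, map_smul, LinearMap.smul_apply, map_smul, smul_eq_mul, smul_eq_mul]
      linear_combination a * h x y
  -- §A `tr(T|_W) = 0`
  have hTW : ∀ w ∈ W, T w ∈ W := fun w hw => UnitaryTheta.apply_mem_eigenspace_of_commute hTφ hw
  have hN : ψC.Nondegenerate :=
    ⟨fun _ hx => ψ.eq_zero_of_forall_form_eq_zero hx, fun _ hy => ψ.eq_zero_of_forall_form_eq_zero' hy⟩
  have htrT : LinearMap.trace ℂ _ T = 0 := WeilProductCM.trace_eq_zero_of_skew hN hTskew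
  have htrW : LinearMap.trace ℂ ↥W (T.restrict hTW) = 0 := by
    have h := WeilProductCM.two_mul_mul_trace_restrict_eq hd hφ2 hμ hTφ hTW
    rw [htrT, htr, mul_zero, zero_add] at h
    exact (mul_eq_zero.1 h).resolve_left (mul_ne_zero two_ne_zero hμ0)
  -- §B every combination of commutators of `End(W)` is the restriction of an element of `S`
  have hP : ∀ T₀ ∈ Submodule.span ℂ {C : Module.End ℂ ↥W | ∃ A₀ B₀ : Module.End ℂ ↥W, C = A₀ * B₀ - B₀ * A₀},
      ∃ D ∈ S, ∀ w : ↥W, D (w : ℂ ⊗[ℚ] V) = (T₀ w : ℂ ⊗[ℚ] V) := by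
    intro T₀ hT₀
    induction hT₀ using Submodule.span_induction with
    | mem C hC =>
      obtain ⟨A₀, B₀, rfl⟩ := hC
      obtain ⟨A, hAφ, hAs, hAW⟩ := UnitarySU.exists_extension H hn ψ hφE hd hφ2 hE hμ A₀
      obtain ⟨B, hBφ, hBs, hBW⟩ := UnitarySU.exists_extension H hn ψ hφE hd hφ2 hE hμ B₀
      refine ⟨A * B - B * A, Submodule.subset_span ⟨A, B, hAφ, hBφ, hAs, hBs, rfl⟩, fun w => ?_⟩
      rw [LinearMap.sub_apply, Module.End.mul_apply, Module.End.mul_apply, hBW, hAW, hAW, hBW, LinearMap.sub_apply,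
        Module.End.mul_apply, Module.End.mul_apply, Submodule.coe_sub]
    | zero => exact ⟨0, Submodule.zero_mem _, fun w => by rw [LinearMap.zero_apply, LinearMap.zero_apply, Submodule.coe_zero]⟩
    | add T₀ T₀' _ _ h h' =>
      obtain ⟨D, hD, hDw⟩ := h
      obtain ⟨D', hD', hD'w⟩ := h'
      exact ⟨D + D', Submodule.add_mem _ hD hD', fun w => by
        rw [LinearMap.add_apply, hDw, hD'w, LinearMap.add_apply, Submodule.coe_add]⟩
    | smul a T₀ _ h =>
      obtain ⟨D, hD, hDw⟩ := h
      exact ⟨a • D, Submodule.smul_mem _ a hD, fun w => by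
        rw [LinearMap.smul_apply, hDw, LinearMap.smul_apply, Submodule.coe_smul]⟩
  -- §C `T|_W` is such a combination (§1, transported by a basis of `W`)
  have hTWmem : T.restrict hTW ∈
      Submodule.span ℂ {C : Module.End ℂ ↥W | ∃ A₀ B₀ : Module.End ℂ ↥W, C = A₀ * B₀ - B₀ * A₀} := by
    let b := Module.finBasis ℂ ↥W
    have hM : (LinearMap.toMatrix b b (T.restrict hTW)).trace = 0 := by
      rw [← LinearMap.trace_eq_matrix_trace]
      exact htrW
    have hmem := UnitarySU.matrix_mem_span_commutator_of_trace_eq_zero _ hM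
    have himg : Submodule.map (Matrix.toLin b b).toLinearMap
        (Submodule.span ℂ {C : Matrix (Fin (Module.finrank ℂ ↥W)) (Fin (Module.finrank ℂ ↥W)) ℂ |
          ∃ A B : Matrix (Fin (Module.finrank ℂ ↥W)) (Fin (Module.finrank ℂ ↥W)) ℂ, C = A * B - B * A}) ≤
        Submodule.span ℂ {C : Module.End ℂ ↥W | ∃ A₀ B₀ : Module.End ℂ ↥W, C = A₀ * B₀ - B₀ * A₀} := by
      rw [Submodule.map_span_le]
      rintro _ ⟨A, B, rfl⟩
      refine Submodule.subset_span ⟨Matrix.toLin b b A, Matrix.toLin b b B, ?_⟩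
      rw [LinearEquiv.coe_toLinearMap, map_sub, Matrix.toLin_mul b b b, Matrix.toLin_mul b b b]
      rfl
    have hTeq : T.restrict hTW = Matrix.toLin b b (LinearMap.toMatrix b b (T.restrict hTW)) := by
      rw [Matrix.toLin_toMatrix]
    rw [hTeq]
    exact himg (Submodule.mem_map_of_mem hmem)
  -- §D the lift agrees with `T` on `W`, hence equals `T`
  obtain ⟨D, hD, hDw⟩ := hP _ hTWmem
  have hTD : T - D = 0 :=
    UnitaryTheta.eq_zero_of_forall_mem_eigenspace H ψ hφE hd hφ2 hE hμ (D := T - D)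
      (by rw [sub_mul, mul_sub, hTφ, hSφ D hD])
      (fun x y => by
        rw [LinearMap.sub_apply, LinearMap.sub_apply, map_sub, LinearMap.sub_apply, map_sub]
        linear_combination hTskew x y - hSskew D hD x y)
      (fun w hw => by
        rw [LinearMap.sub_apply, hDw ⟨w, hw⟩, sub_eq_zero]
        rfl)
  rw [sub_eq_zero] at hTD
  rw [hTD]
  exact hD

end HodgeStructure

end Literature.AlgebraicGeometry.Motives
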